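import Literature.MathematicalPhysics.QuantumLattice.KroneckerTraceSchwarz
import HarnessLib

/-!
# The antilinear (fermionic) Dyson–Lieb–Simon trace inequality

Support file for the proof of Lieb's flux-phase theorem `Lieb1994_fluxPi_torus`
(`LiebFluxPhase.lean`; E. H. Lieb, *Flux phase of the half-filled band*, PRL **73** (1994) 2158,
Lemma "reflection positivity", eq. (6)). `KroneckerTraceSchwarz.lean` proves the DLS inequality
[DLS1978, Lemma 4.1] for REAL matrices,
`Tr e^{A⊗1+1⊗B+ΣMᵢ⊗Nᵢ} ≤ (Tr e^{A⊗1+1⊗A+ΣMᵢ⊗Mᵢ})^{1/2} (Tr e^{B⊗1+1⊗B+ΣNᵢ⊗Nᵢ})^{1/2}`.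
Lieb's reflection `Θ(A) = (τ R(A) τ⁻¹)^*` [Lieb1994, p. 3] is ANTILINEAR ("complex conjugation
`*`"), and the identity behind his Schwarz step is `(Tr X_L)^* = Tr Θ(X_L)`, so
`Tr X_L Θ(X_L) = |Tr X_L|²` [Lieb1994, p. 4]. At the matrix level this is the following
generalisation, proved here: for ANY complex square matrices and any map of the form
`J_V(X) = V X̄ V⋆` (`Matrix.antiConj V X`, `X̄ = Xᴴᵀ` the entrywise conjugate, `V` with
`V⋆V = 1`, `VV⋆ = 1`) — an antilinear, unital, multiplicative map with `Tr J_V(X) = (Tr X)^*` —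
and independently a second such map `J_{V'}`,

`|Tr exp(A⊗1 + 1⊗B + Σᵢ Mᵢ⊗Nᵢ)| ≤ (Re Tr exp(A⊗1 + 1⊗J_V A + Σᵢ Mᵢ⊗J_V Mᵢ))^{1/2} ·
   (Re Tr exp(J_{V'}B⊗1 + 1⊗B + Σᵢ J_{V'}Nᵢ⊗Nᵢ))^{1/2}`

(`Matrix.norm_trace_exp_kroneckerSum_le_antiConj`). The proof is the one of
`Matrix.trace_exp_kroneckerSum_le` ([LSSY2005] Ch. 11 (11.5)–(11.7), Euler approximants
`(1 + A/N)⊗(1 + B/N) + N⁻¹ΣMᵢ⊗Nᵢ`, expansion into ordered words, factorisation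
`Tr(X⊗Y) = Tr X · Tr Y`), with the complex Cauchy–Schwarz inequality
`|Σ_c p_c q_c|² ≤ Σ_c |p_c|² Σ_c |q_c|²` and `Σ_c |Tr X_c|² = Tr (Σₐ Xₐ ⊗ J Xₐ)^N`
(`Matrix.norm_trace_pow_kroneckerSum_le_antiConj`).

## References

* [Lieb1994] E. H. Lieb, Phys. Rev. Lett. 73 (1994) 2158–2161, Lemma (eq. (6)) and its proof.
* [DLS1978] F. J. Dyson, E. H. Lieb, B. Simon, J. Stat. Phys. 18 (1978) 335–383, Lemma 4.1.
* [LSSY2005] E. H. Lieb, R. Seiringer, J. P. Solovej, J. Yngvason, *The Mathematics of the Bose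
  Gas and its Condensation* (2005), Ch. 11, (11.5)–(11.7).
-/

noncomputable section

open NormedSpace Filter Topology Finset
open scoped Kronecker

namespace Matrix

open Literature.MathematicalPhysics.QuantumLattice

/-! ### Antilinear conjugations `X ↦ V X̄ V⋆` -/

section AntiConj

variable {m n : Type*} [Fintype m] [Fintype n] [DecidableEq m] [DecidableEq n]

/-- The antilinear conjugation `J_V(X) = V X̄ Vᴴ` by a (rectangular) matrix `V`, where
`X̄ = Xᴴᵀ` is the entrywise complex conjugate. For `V` unitary this is an antilinear unital
`*`-isomorphism of matrix algebras with `Tr J_V(X) = (Tr X)^*` — the matrix form of Lieb's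
operator reflection `Θ` [Lieb1994, p. 3: `Θ(H_L) = (τ R(H_L) τ⁻¹)^*`].
[cite: Lieb1994, p. 3 (definition of `Θ`)] -/
def antiConj (V : Matrix n m ℂ) (X : Matrix m m ℂ) : Matrix n n ℂ := V * Xᴴᵀ * Vᴴ

omit [Fintype n] [DecidableEq m] [DecidableEq n] in
/-- Unfolding lemma for `antiConj`. [folklore] -/
theorem antiConj_def (V : Matrix n m ℂ) (X : Matrix m m ℂ) : antiConj V X = V * Xᴴᵀ * Vᴴ := rfl

omit [Fintype n] [DecidableEq m] [DecidableEq n] in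
/-- `J_V` is additive. [folklore] -/
theorem antiConj_add (V : Matrix n m ℂ) (X Y : Matrix m m ℂ) :
    antiConj V (X + Y) = antiConj V X + antiConj V Y := by
  simp [antiConj, conjTranspose_add, transpose_add, Matrix.mul_add, Matrix.add_mul]

omit [Fintype n] [DecidableEq m] [DecidableEq n] in
/-- `J_V` is antilinear: `J_V(c X) = c^* J_V(X)`. [folklore] -/
theorem antiConj_smul (V : Matrix n m ℂ) (c : ℂ) (X : Matrix m m ℂ) :
    antiConj V (c • X) = star c • antiConj V X := by
  simp [antiConj, conjTranspose_smul, transpose_smul, Matrix.mul_smul, Matrix.smul_mul]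

omit [Fintype n] [DecidableEq m] [DecidableEq n] in
/-- `J_V` commutes with REAL scalars. [folklore] -/
theorem antiConj_ofReal_smul (V : Matrix n m ℂ) (r : ℝ) (X : Matrix m m ℂ) :
    antiConj V ((r : ℂ) • X) = (r : ℂ) • antiConj V X := by
  rw [antiConj_smul, Complex.star_def, Complex.conj_ofReal]

omit [Fintype n] [DecidableEq m] [DecidableEq n] in
/-- `J_V(0) = 0`. [folklore] -/
@[simp] theorem antiConj_zero (V : Matrix n m ℂ) : antiConj V (0 : Matrix m m ℂ) = 0 := by
  simp [antiConj]

omit [Fintype n] in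
/-- `J_V(1) = 1` when `V Vᴴ = 1`. [folklore] -/
theorem antiConj_one {V : Matrix n m ℂ} (hV : V * Vᴴ = 1) : antiConj V (1 : Matrix m m ℂ) = 1 := by
  rw [antiConj, conjTranspose_one, transpose_one, Matrix.mul_one, hV]

omit [DecidableEq n] in
/-- `J_V` is multiplicative when `Vᴴ V = 1`. [folklore] -/
theorem antiConj_mul {V : Matrix n m ℂ} (hV : Vᴴ * V = 1) (X Y : Matrix m m ℂ) :
    antiConj V (X * Y) = antiConj V X * antiConj V Y := by
  simp only [antiConj, conjTranspose_mul, transpose_mul]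
  rw [Matrix.mul_assoc (V * Xᴴᵀ) Vᴴ, ← Matrix.mul_assoc Vᴴ, ← Matrix.mul_assoc Vᴴ, hV,
    Matrix.one_mul]
  simp only [Matrix.mul_assoc]

omit [Fintype n] [DecidableEq m] [DecidableEq n] in
/-- `J_V` sends finite sums to finite sums. [folklore] -/
theorem antiConj_sum {ι : Type*} (V : Matrix n m ℂ) (s : Finset ι) (X : ι → Matrix m m ℂ) :
    antiConj V (∑ i ∈ s, X i) = ∑ i ∈ s, antiConj V (X i) := by
  simp [antiConj, conjTranspose_sum, transpose_sum, Matrix.mul_sum, Matrix.sum_mul]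

omit [DecidableEq n] in
/-- `Tr J_V(X) = (Tr X)^*` when `Vᴴ V = 1`. This is Lieb's `(Tr X_L)^* = Tr Θ(X_L)`
[Lieb1994, p. 4]. [cite: Lieb1994, p. 4] -/
theorem trace_antiConj {V : Matrix n m ℂ} (hV : Vᴴ * V = 1) (X : Matrix m m ℂ) :
    (antiConj V X).trace = star X.trace := by
  rw [antiConj, trace_mul_cycle, hV, Matrix.one_mul, trace_transpose, trace_conjTranspose]

/-- `J_V` of an ordered product is the ordered product of the `J_V`'s (for `V` unitary).
[folklore] -/
theorem antiConj_ofFn_prod {V : Matrix n m ℂ} (hV : Vᴴ * V = 1)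
    (hV' : V * Vᴴ = 1) {N : ℕ} (P : Fin N → Matrix m m ℂ) :
    antiConj V (List.ofFn P).prod = (List.ofFn fun k => antiConj V (P k)).prod := by
  induction N with
  | zero => simp [antiConj_one hV']
  | succ N ih =>
    rw [List.ofFn_succ, List.ofFn_succ, List.prod_cons, List.prod_cons, antiConj_mul hV, ih]

end AntiConj

/-! ### The trace Schwarz inequality for powers, antilinear form -/

section Pow

variable {m n m' n' : Type*} [Fintype m] [Fintype n] [Fintype m'] [Fintype n']
  [DecidableEq m] [DecidableEq n] [DecidableEq m'] [DecidableEq n']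

/-- For a unitary `V`, `Re Tr (Σₐ Xₐ ⊗ J_V Xₐ)^N = Σ_c |Tr X_c|²` over the ordered words `c`
(`X_c = X_{c₀}⋯X_{c_{N-1}}`): the "diagonal" trace is a sum of squares
[Lieb1994, p. 4: "`|Tr X_L|² = Tr X_L Θ(X_L)`"]. [cite: Lieb1994, p. 4] -/
theorem trace_pow_kroneckerSum_antiConj_eq {C : Type*} [Fintype C] (X : C → Matrix m m ℂ)
    {V : Matrix n' m ℂ} (hV : Vᴴ * V = 1) (hV' : V * Vᴴ = 1) (N : ℕ) :
    ((∑ a, X a ⊗ₖ antiConj V (X a)) ^ N).trace =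
      ((∑ c : Fin N → C, ‖(List.ofFn fun k => X (c k)).prod.trace‖ ^ 2 : ℝ) : ℂ) := by
  rw [sum_pow_eq_sum_ofFn_prod, trace_sum, Complex.ofReal_sum]
  refine sum_congr rfl fun c _ => ?_
  rw [ofFn_prod_kronecker, trace_kronecker, ← antiConj_ofFn_prod hV hV', trace_antiConj hV,
    Complex.star_def, Complex.mul_conj, Complex.normSq_eq_norm_sq]

/-- The mirror statement: `Tr (Σₐ J_{V'} Yₐ ⊗ Yₐ)^N = Σ_c |Tr Y_c|²`. [cite: Lieb1994, p. 4] -/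
theorem trace_pow_kroneckerSum_antiConj_eq' {C : Type*} [Fintype C] (Y : C → Matrix n n ℂ)
    {V' : Matrix m' n ℂ} (hV : V'ᴴ * V' = 1) (hV' : V' * V'ᴴ = 1) (N : ℕ) :
    ((∑ a, antiConj V' (Y a) ⊗ₖ Y a) ^ N).trace =
      ((∑ c : Fin N → C, ‖(List.ofFn fun k => Y (c k)).prod.trace‖ ^ 2 : ℝ) : ℂ) := by
  rw [sum_pow_eq_sum_ofFn_prod, trace_sum, Complex.ofReal_sum]
  refine sum_congr rfl fun c _ => ?_
  rw [ofFn_prod_kronecker, trace_kronecker, ← antiConj_ofFn_prod hV hV', trace_antiConj hV,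
    Complex.star_def, mul_comm, Complex.mul_conj, Complex.normSq_eq_norm_sq]

/-- **Trace Schwarz inequality for separable sums, antilinear form** (the algebraic core of
Lieb's reflection-positivity Lemma [Lieb1994, eq. (6)], at the level of the Trotter/Euler
approximants: `|Σ_α Tr X^α_L Tr X^α_R|² ≤ Σ_α |Tr X^α_L|² Σ_α |Tr X^α_R|²`, p. 4): for arbitrary
complex square matrices `Xₐ` (size `m`), `Yₐ` (size `n`), unitaries `V`, `V'` and every `N`,
`|Tr (Σₐ Xₐ⊗Yₐ)^N| ≤ (Re Tr (Σₐ Xₐ⊗J_V Xₐ)^N)^{1/2} (Re Tr (Σₐ J_{V'}Yₐ⊗Yₐ)^N)^{1/2}`.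
[cite: Lieb1994, proof of the Lemma, p. 4] -/
theorem norm_trace_pow_kroneckerSum_le_antiConj {C : Type*} [Fintype C] (X : C → Matrix m m ℂ)
    (Y : C → Matrix n n ℂ) {V : Matrix n' m ℂ} (hV : Vᴴ * V = 1) (hV' : V * Vᴴ = 1)
    {V' : Matrix m' n ℂ} (hW : V'ᴴ * V' = 1) (hW' : V' * V'ᴴ = 1) (N : ℕ) :
    ‖((∑ a, X a ⊗ₖ Y a) ^ N).trace‖ ≤
      Real.sqrt (((∑ a, X a ⊗ₖ antiConj V (X a)) ^ N).trace).re *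
        Real.sqrt (((∑ a, antiConj V' (Y a) ⊗ₖ Y a) ^ N).trace).re := by
  set p : (Fin N → C) → ℂ := fun c => (List.ofFn fun k => X (c k)).prod.trace with hp
  set q : (Fin N → C) → ℂ := fun c => (List.ofFn fun k => Y (c k)).prod.trace with hq
  have hXY : ((∑ a, X a ⊗ₖ Y a) ^ N).trace = ∑ c : Fin N → C, p c * q c := by
    rw [sum_pow_eq_sum_ofFn_prod, trace_sum]
    refine sum_congr rfl fun c _ => ?_
    rw [ofFn_prod_kronecker, trace_kronecker]
  have hXX : (((∑ a, X a ⊗ₖ antiConj V (X a)) ^ N).trace).re = ∑ c : Fin N → C, ‖p c‖ ^ 2 := by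
    rw [trace_pow_kroneckerSum_antiConj_eq X hV hV', Complex.ofReal_re]
  have hYY : (((∑ a, antiConj V' (Y a) ⊗ₖ Y a) ^ N).trace).re = ∑ c : Fin N → C, ‖q c‖ ^ 2 := by
    rw [trace_pow_kroneckerSum_antiConj_eq' Y hW hW', Complex.ofReal_re]
  rw [hXY, hXX, hYY]
  -- complex Cauchy–Schwarz through the real one for the moduli
  have hCS := Finset.sum_mul_sq_le_sq_mul_sq (univ : Finset (Fin N → C)) (fun c => ‖p c‖)
    (fun c => ‖q c‖)
  have hpp : 0 ≤ ∑ c : Fin N → C, ‖p c‖ ^ 2 := sum_nonneg fun c _ => sq_nonneg _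
  calc ‖∑ c : Fin N → C, p c * q c‖ ≤ ∑ c : Fin N → C, ‖p c * q c‖ := norm_sum_le _ _
    _ = ∑ c : Fin N → C, ‖p c‖ * ‖q c‖ := sum_congr rfl fun c _ => norm_mul _ _
    _ ≤ |∑ c : Fin N → C, ‖p c‖ * ‖q c‖| := le_abs_self _
    _ ≤ Real.sqrt ((∑ c : Fin N → C, ‖p c‖ ^ 2) * ∑ c : Fin N → C, ‖q c‖ ^ 2) :=
        Real.abs_le_sqrt hCS
    _ = Real.sqrt (∑ c : Fin N → C, ‖p c‖ ^ 2) * Real.sqrt (∑ c : Fin N → C, ‖q c‖ ^ 2) :=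
        Real.sqrt_mul hpp _

end Pow

/-! ### The limit: exponentials of Kronecker sums, antilinear form -/

section Exp

variable {m n m' n' : Type*} [Fintype m] [Fintype n] [Fintype m'] [Fintype n']
  [DecidableEq m] [DecidableEq n] [DecidableEq m'] [DecidableEq n']

omit [Fintype n'] in
/-- `J_V` maps the Euler approximating family of `(A, Mᵢ)` to that of `(J_V A, J_V Mᵢ)`
(it is additive, unital and commutes with real scalars). [folklore] -/
theorem antiConj_approximant {ι : Type*} (A : Matrix m m ℂ) (M : ι → Matrix m m ℂ)
    {V : Matrix n' m ℂ} (hV' : V * Vᴴ = 1) (N : ℕ) (a : Option ι) :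
    antiConj V (Option.elim a ((1 : Matrix m m ℂ) + ((N : ℂ))⁻¹ • A)
        (fun i => (((Real.sqrt N)⁻¹ : ℝ) : ℂ) • M i)) =
      Option.elim a ((1 : Matrix n' n' ℂ) + ((N : ℂ))⁻¹ • antiConj V A)
        (fun i => (((Real.sqrt N)⁻¹ : ℝ) : ℂ) • antiConj V (M i)) := by
  rcases a with _ | i
  · simp only [Option.elim_none]
    rw [antiConj_add, antiConj_one hV', antiConj_smul, Complex.star_def, map_inv₀,
      Complex.conj_natCast]
  · simp only [Option.elim_some]
    rw [antiConj_ofReal_smul]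

variable [Nonempty m] [Nonempty n] [Nonempty m'] [Nonempty n']

/-- **The antilinear Dyson–Lieb–Simon trace inequality** (matrix form of Lieb's
reflection-positivity Lemma [Lieb1994, eq. (6)]: `Z(H_L,H_R)² ≤ Z(H_L,Θ(H_L)) Z(Θ(H_R),H_R)`,
with `Θ` realised by the antilinear conjugations `J_V`, `J_{V'}` of unitaries `V`, `V'`): for
arbitrary complex square matrices `A, Mᵢ` (size `m`), `B, Nᵢ` (size `n`),
`|Tr exp(A⊗1 + 1⊗B + ΣᵢMᵢ⊗Nᵢ)| ≤ (Re Tr exp(A⊗1 + 1⊗J_V A + ΣᵢMᵢ⊗J_V Mᵢ))^{1/2} ·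
  (Re Tr exp(J_{V'}B⊗1 + 1⊗B + ΣᵢJ_{V'}Nᵢ⊗Nᵢ))^{1/2}`.
Proof: `norm_trace_pow_kroneckerSum_le_antiConj` for the Euler approximants and the product
formula `tendsto_approximant_pow` ([LSSY2005] Ch. 11 (11.5); Lieb uses the Lie–Trotter formula
with the linear factor `V_int = 1 - βH_int/M`, p. 3). [cite: Lieb1994, Lemma, eq. (6)]
[cite: LSSY2005, Ch. 11 (11.5)–(11.7)] -/
theorem norm_trace_exp_kroneckerSum_le_antiConj {ι : Type*} [Fintype ι] (A : Matrix m m ℂ)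
    (B : Matrix n n ℂ) (M : ι → Matrix m m ℂ) (Nn : ι → Matrix n n ℂ) {V : Matrix n' m ℂ}
    (hV : Vᴴ * V = 1) (hV' : V * Vᴴ = 1) {V' : Matrix m' n ℂ} (hW : V'ᴴ * V' = 1)
    (hW' : V' * V'ᴴ = 1) :
    ‖(exp (A ⊗ₖ (1 : Matrix n n ℂ) + (1 : Matrix m m ℂ) ⊗ₖ B + ∑ i, M i ⊗ₖ Nn i)).trace‖ ≤
      Real.sqrt (exp (A ⊗ₖ (1 : Matrix n' n' ℂ) + (1 : Matrix m m ℂ) ⊗ₖ antiConj V A +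
          ∑ i, M i ⊗ₖ antiConj V (M i))).trace.re *
        Real.sqrt (exp (antiConj V' B ⊗ₖ (1 : Matrix n n ℂ) + (1 : Matrix m' m' ℂ) ⊗ₖ B +
          ∑ i, antiConj V' (Nn i) ⊗ₖ Nn i)).trace.re := by
  -- the approximating families
  set X : ℕ → Option ι → Matrix m m ℂ := fun N a =>
    Option.elim a ((1 : Matrix m m ℂ) + ((N : ℂ))⁻¹ • A) (fun i => (((Real.sqrt N)⁻¹ : ℝ) : ℂ) • M i)
    with hXdef
  set Y : ℕ → Option ι → Matrix n n ℂ := fun N a =>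
    Option.elim a ((1 : Matrix n n ℂ) + ((N : ℂ))⁻¹ • B) (fun i => (((Real.sqrt N)⁻¹ : ℝ) : ℂ) • Nn i)
    with hYdef
  have hJX : ∀ N a, antiConj V (X N a) = Option.elim a ((1 : Matrix n' n' ℂ) +
      ((N : ℂ))⁻¹ • antiConj V A) (fun i => (((Real.sqrt N)⁻¹ : ℝ) : ℂ) • antiConj V (M i)) :=
    fun N a => antiConj_approximant A M hV' N a
  have hJY : ∀ N a, antiConj V' (Y N a) = Option.elim a ((1 : Matrix m' m' ℂ) +
      ((N : ℂ))⁻¹ • antiConj V' B) (fun i => (((Real.sqrt N)⁻¹ : ℝ) : ℂ) • antiConj V' (Nn i)) :=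
    fun N a => antiConj_approximant B Nn hW' N a
  -- the inequality for every `N`
  have hN : ∀ N : ℕ, ‖((∑ a, X N a ⊗ₖ Y N a) ^ N).trace‖ ≤
      Real.sqrt (((∑ a, X N a ⊗ₖ antiConj V (X N a)) ^ N).trace).re *
        Real.sqrt (((∑ a, antiConj V' (Y N a) ⊗ₖ Y N a) ^ N).trace).re :=
    fun N => norm_trace_pow_kroneckerSum_le_antiConj (X N) (Y N) hV hV' hW hW' N
  -- the three limits
  have hXY : Tendsto (fun N : ℕ => ‖((∑ a, X N a ⊗ₖ Y N a) ^ N).trace‖) atTop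
      (𝓝 ‖(exp (A ⊗ₖ (1 : Matrix n n ℂ) + (1 : Matrix m m ℂ) ⊗ₖ B + ∑ i, M i ⊗ₖ Nn i)).trace‖) := by
    have h := tendsto_approximant_pow A B M Nn
    have h2 := (continuous_norm.tendsto _).comp
      (((Matrix.traceLinearMap (m × n) ℂ ℂ).continuous_of_finiteDimensional.tendsto _).comp h)
    refine h2.congr fun N => ?_
    simp only [Function.comp_apply, Matrix.traceLinearMap_apply, hXdef, hYdef,
      sum_option_kronecker_approximant]
  have hXX : Tendsto (fun N : ℕ => Real.sqrt (((∑ a, X N a ⊗ₖ antiConj V (X N a)) ^ N).trace).re)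
      atTop (𝓝 (Real.sqrt (exp (A ⊗ₖ (1 : Matrix n' n' ℂ) + (1 : Matrix m m ℂ) ⊗ₖ antiConj V A +
        ∑ i, M i ⊗ₖ antiConj V (M i))).trace.re)) := by
    have h := tendsto_approximant_pow A (antiConj V A) M (fun i => antiConj V (M i))
    have h2 := ((Real.continuous_sqrt.comp Complex.continuous_re).tendsto _).comp
      (((Matrix.traceLinearMap (m × n') ℂ ℂ).continuous_of_finiteDimensional.tendsto _).comp h)
    refine h2.congr fun N => ?_
    simp only [Function.comp_apply, Matrix.traceLinearMap_apply]
    simp_rw [hJX N, hXdef, sum_option_kronecker_approximant]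
  have hYY : Tendsto (fun N : ℕ => Real.sqrt (((∑ a, antiConj V' (Y N a) ⊗ₖ Y N a) ^ N).trace).re)
      atTop (𝓝 (Real.sqrt (exp (antiConj V' B ⊗ₖ (1 : Matrix n n ℂ) + (1 : Matrix m' m' ℂ) ⊗ₖ B +
        ∑ i, antiConj V' (Nn i) ⊗ₖ Nn i)).trace.re)) := by
    have h := tendsto_approximant_pow (antiConj V' B) B (fun i => antiConj V' (Nn i)) Nn
    have h2 := ((Real.continuous_sqrt.comp Complex.continuous_re).tendsto _).comp
      (((Matrix.traceLinearMap (m' × n) ℂ ℂ).continuous_of_finiteDimensional.tendsto _).comp h)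
    refine h2.congr fun N => ?_
    simp only [Function.comp_apply, Matrix.traceLinearMap_apply]
    simp_rw [hJY N, hYdef, sum_option_kronecker_approximant]
  exact le_of_tendsto_of_tendsto' hXY (hXX.mul hYY) hN

end Exp

end Matrix

end
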